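import Summits.Ventures.KdS.RouteW
import Literature.Geometry.Lorentzian.KerrDeSitterHiddenSymmetryEnergy
import HarnessLib

/-!
# Venture KdS — route W, input K₂: `RouteW.SwappedEnergyVanishing` holds

`swappedEnergyVanishing_holds : RouteW.SwappedEnergyVanishing` — Casals–Teixeira da Costa's
Theorem 3.10, proof Step 2 (energy identity for the `m₂ ↔ m₃`-transformed radial ODE (3.25) under
the boundary conditions (3.26), `Im ω > 0`, `0 ≤ a`), discharged by the Literature theorem
`Literature.Geometry.Lorentzian.KerrDeSitter.ctdcStep2_of_normalFormModeData`
(`Literature/Geometry/Lorentzian/KerrDeSitterHiddenSymmetryEnergy.lean`, §Assembly), whose hypotheses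
are the three conjuncts of `RouteW.NormalFormModeData (zTwo M a Λ) (tildeCoeff M a Λ s ω m lam)
(1/2+η₀+η₁) (1/2−η₀−η₂) R̃` verbatim (`zTwo`, `tildeCoeff`, `ltBlock` unfold definitionally).
-/

namespace Summit.Ventures.KdS.RouteW

open Set

/-- **K₂ of route W.** [cite: CasalsTeixeiradacosta2022, Theorem 3.10 (proof, Step 2) with Corollary 3.10 (3.25)–(3.26)] -/
theorem swappedEnergyVanishing_holds : SwappedEnergyVanishing := by
  intro M a Λ s ω m lam Rt hsub ha hω hlam hwin hD
  obtain ⟨hode, h1, h2⟩ := hD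
  exact Literature.Geometry.Lorentzian.KerrDeSitter.ctdcStep2_of_normalFormModeData
    hsub ha hω hlam hwin hode h1 h2

end Summit.Ventures.KdS.RouteW
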